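import Summits.QuantumFields.YangMills.Theorems.UnitScaleTiltProp8HalvingA1Row165TraceL5
import HarnessLib

/-!
# Route `UnitScaleTilt`, crux K1 child «MinimiserStabilityRegPr» (stmt-QuantumFields-19200), registered stub V2′ `stub_halvingStep`
# (skeletons v8 5b4e846794b80374 / v10 `BirthV10`) — **THE (165)-A₁ ROW FROM THE TRACE PAIRING WITH AN ARBITRARY (NOT NECESSARILY SELF-ADJOINT) CURRENT**
# (owner socket (σ-3) ∕ MAP #3 M3, file 10 — robustness of file 9): P3b's gradient `W₀` (`FlatActionGradient.exists_gradient_action_T3`, holomorphic in `A`) is NOT stated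
# bondwise self-adjoint; but for self-adjoint test matrices only the SELF-ADJOINT PART `½(W₀ + W₀ᴴ)` of the current is seen by the trace pairing (`Re tr(K·E) = 0` for `K`
# anti-self-adjoint, `E` self-adjoint), it has the same (98) sup letter (`‖½(M + Mᴴ)‖ ≤ ‖M‖`, `Matrix.l2_opNorm_conjTranspose`), and it IS bondwise self-adjoint — so
# `HalvingA1Row165TraceL5.row165_of_tracePairing_L5` holds WITHOUT the hypothesis `∀ b, IsSelfAdjoint (W₀A′ b)`, same constants

Cell `ym3-torus` (HUMAN RULING D-0037, YM ladder rung R3 — continuum SU(2) YM₃ on the torus is a RUNG, not the Clay problem), width seat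
`ym-ust-19200-w3` gen 3 (D-0149).  `--supports stmt-QuantumFields-19200 --as helper`; def-free, 0 sorry, standard axioms.

WHAT THIS FILE PROVES (no definition, no sorry):
* `re_trace_antiHerm_mul_selfAdjoint` (`Re tr((M − Mᴴ)·E) = 0` for self-adjoint `E`), `re_trace_mul_eq_hermPart` (`Re tr(M·(tE)) = Re tr(½(M + Mᴴ)·(tE))`),
  `norm_hermPart_le` (`‖½(M + Mᴴ)‖ ≤ ‖M‖`), `isSelfAdjoint_hermPart`;
* **`row165_of_tracePairing_L5_anyW`** — file 9's theorem with the self-adjointness hypothesis on the current DROPPED (everything else, incl. the constants, byte-identical).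
HONEST SCOPE as in file 9; NOT a claim about the crux, the rung, or the mass gap.

References: T. Bałaban, CMP **102** (1985) 277–309 [Balaban1985Variational] (99)–(100) p.293, (127) p.297, (158) p.302, (165) p.304.
-/

set_option autoImplicit false

noncomputable section

open scoped BigOperators InnerProductSpace Matrix Matrix.Norms.L2Operator ComplexConjugate

namespace Summit.QuantumFields.YangMills.Theorems.HalvingA1Row165TraceAnyW

open Literature.MathematicalPhysics.QuantumFieldTheory.Balaban1983to89
open B6GlobalChartV1 (PV)
open B6SectADomainsV1 (Domains)
open B6SectAOperatorsV1 (BondIdx QE RE dsE)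
open B8Ineq132 (BondTouches)
open B8Eq140Level (SideTouches)
open B8Eq143PlaqExpansion (pdiv)
open B8Eq146AExpansion (plaqCovDeriv)
open B8Thm2SetupTorus (pullDom)
open B10Eq27TorusAxialLog (pull transl)
open LatticeFieldCalculus (bondAvgIter)
open T3ContinuumYM3Torus (T3Family)
open FlatCubeOpsText (IsLevWeight)
open FlatOpsLettersAssembly (flatH)
open FlatCubeSequenceAligned (cubeSeqMT3)
open HalvingA1Row165TraceL5 (row165_of_tracePairing_L5)

/-! ## §1 The self-adjoint part of the current -/

section Herm

/-- `Re tr((M − Mᴴ)·E) = 0` for self-adjoint `E`: the trace of an anti-self-adjoint times a self-adjoint matrix is imaginary. [folklore] -/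
theorem re_trace_antiHerm_mul_selfAdjoint (M E : Matrix (Fin 2) (Fin 2) ℂ) (hE : IsSelfAdjoint E) :
    (Matrix.trace ((M - Mᴴ) * E)).re = 0 := by
  have hEH : Eᴴ = E := by rw [← Matrix.star_eq_conjTranspose]; exact hE.star_eq
  have h : conj (Matrix.trace ((M - Mᴴ) * E)) = -Matrix.trace ((M - Mᴴ) * E) := by
    rw [← Complex.star_def, ← Matrix.trace_conjTranspose, Matrix.conjTranspose_mul, Matrix.conjTranspose_sub, Matrix.conjTranspose_conjTranspose, hEH,
      Matrix.trace_mul_comm, ← Matrix.trace_neg, ← Matrix.neg_mul, neg_sub]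
  have hre := congrArg Complex.re h
  rw [Complex.conj_re, Complex.neg_re] at hre
  linarith

/-- **ONLY THE SELF-ADJOINT PART OF THE CURRENT IS SEEN**: `Re tr(M·(tE)) = Re tr(½(M + Mᴴ)·(tE))` for real `t` and self-adjoint `E`. [cite: Balaban1985Variational, (99)-(100) p.293] -/
theorem re_trace_mul_eq_hermPart (M E : Matrix (Fin 2) (Fin 2) ℂ) (hE : IsSelfAdjoint E) (t : ℝ) :
    (Matrix.trace (M * ((t : ℂ) • E))).re = (Matrix.trace (((1 / 2 : ℝ) • (M + Mᴴ)) * ((t : ℂ) • E))).re := by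
  have htE : IsSelfAdjoint ((t : ℂ) • E) := by
    rw [Complex.coe_smul]
    exact IsSelfAdjoint.smul (IsSelfAdjoint.all t) hE
  have h0 := re_trace_antiHerm_mul_selfAdjoint M ((t : ℂ) • E) htE
  have hsplit : M = (1 / 2 : ℝ) • (M + Mᴴ) + (1 / 2 : ℝ) • (M - Mᴴ) := by
    rw [← smul_add]
    have : M + Mᴴ + (M - Mᴴ) = (2 : ℝ) • M := by rw [two_smul]; abel
    rw [this, smul_smul]; norm_num
  conv_lhs => rw [hsplit]
  simp only [Matrix.add_mul, Matrix.smul_mul, Matrix.trace_add, Matrix.trace_smul, Complex.add_re, Complex.smul_re, h0, smul_zero, add_zero]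

/-- `½(M + Mᴴ)` is self-adjoint. [folklore] -/
theorem isSelfAdjoint_hermPart (M : Matrix (Fin 2) (Fin 2) ℂ) : IsSelfAdjoint ((1 / 2 : ℝ) • (M + Mᴴ)) := by
  refine IsSelfAdjoint.smul (IsSelfAdjoint.all _) ?_
  rw [IsSelfAdjoint, Matrix.star_eq_conjTranspose, Matrix.conjTranspose_add, Matrix.conjTranspose_conjTranspose, add_comm]

/-- `‖½(M + Mᴴ)‖ ≤ ‖M‖` (L²-operator norm; `‖Mᴴ‖ = ‖M‖`). [folklore] -/
theorem norm_hermPart_le (M : Matrix (Fin 2) (Fin 2) ℂ) : ‖(1 / 2 : ℝ) • (M + Mᴴ)‖ ≤ ‖M‖ := by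
  rw [norm_smul, Real.norm_of_nonneg (by norm_num : (0 : ℝ) ≤ 1 / 2)]
  have h := norm_add_le M Mᴴ
  rw [Matrix.l2_opNorm_conjTranspose] at h
  linarith

end Herm

/-! ## §2 The (165)-A₁ row from the trace pairing, arbitrary current -/

section Carrier

/-- `1 ≤ 3` (named once). [folklore] -/
private theorem hd3 : 1 ≤ 2 + 1 := by norm_num

/-- **THE (165)-A₁ ROW FROM THE TRACE PAIRING, EVERY ODD `L ≥ 5`, ARBITRARY CURRENT** — `HalvingA1Row165TraceL5.row165_of_tracePairing_L5` with the hypothesis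
`∀ b, IsSelfAdjoint (W₀A′ b)` dropped (apply it to the self-adjoint part `½(W₀ + W₀ᴴ)`, which the pairing cannot distinguish from `W₀` and which has the same (98) letter).
[cite: Balaban1985Variational, (99)-(100) p.293, (127)-(133) pp.297-298, (152)-(153) p.301, (158) p.302, (165) p.304] -/
theorem row165_of_tracePairing_L5_anyW (ℓ : ℕ) (hL : Odd (ℓ + 1) ∧ 1 < ℓ + 1) (hℓ : 4 ≤ ℓ) :
    ∃ (Mh₀ R₀ : ℕ) (B₀ BM : ℝ), 0 ≤ B₀ ∧ 0 ≤ BM ∧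
    ∀ (m : ℕ) (hm : 1 ≤ m) (n K : ℕ) (_ : 1 ≤ K - n) (_ : K - n + 1 ≤ m + K) {Mh R a' : ℕ} (_ : Mh = (ℓ + 1) ^ a') (_ : Mh₀ ≤ Mh) (_ : R₀ ≤ R)
      (_ : a' + 3 ≤ m + n) (hM1 : 1 ≤ (ℓ + 1) * Mh) (x₀ : Site (PV 2 ℓ m K hd3 hL) 0) (ρ S : ℕ) (_ : R * ((ℓ + 1) * Mh) ≤ S) (_ : 1 ≤ ρ)
      (w : ℕ → PBond (PV 2 ℓ m K hd3 hL) 0 → ℝ)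
      (_ : IsLevWeight (⟨ℓ + 1, hL, m, hm⟩ : T3Family) n K (cubeSeqMT3 (⟨ℓ + 1, hL, m, hm⟩ : T3Family) n K x₀ ρ S ((ℓ + 1) * Mh) hM1) w)
      (A' : PBond (PV 2 ℓ m K hd3 hL) 0 → Matrix (Fin 2) (Fin 2) ℂ) (_ : ∀ b, IsSelfAdjoint (A' b))
      (W₀ : (PBond (PV 2 ℓ m K hd3 hL) 0 → Matrix (Fin 2) (Fin 2) ℂ) → (PBond (PV 2 ℓ m K hd3 hL) 0 → Matrix (Fin 2) (Fin 2) ℂ)) {C₄ a₃ r e : ℝ}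
      (_ : ∀ (Y : PBond (PV 2 ℓ m K hd3 hL) 0 → Matrix (Fin 2) (Fin 2) ℂ) (r' : ℝ), r' < a₃ → (∀ b, w 1 b * ‖Y b‖ ≤ r') →
        (∀ (b : PBond (PV 2 ℓ m K hd3 hL) 0) (ν : Fin 3), w 2 b * (((ℓ + 1 : ℕ) : ℝ)) ^ (K - n) * ‖Y ⟨b.src.shift ν, b.dir⟩ - Y b‖ ≤ r') →
        ∀ b, w 3 b * ‖W₀ Y b‖ ≤ C₄ * r' ^ 2)
      (_ : ∀ s : PBond (PV 2 ℓ m K hd3 hL) 0 → ℝ, QE (cubeSeqMT3 (⟨ℓ + 1, hL, m, hm⟩ : T3Family) n K x₀ ρ S ((ℓ + 1) * Mh) hM1) (WithLp.toLp 2 s) = 0 →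
        ∀ E : Matrix (Fin 2) (Fin 2) ℂ, IsSelfAdjoint E →
        (((((((ℓ + 1 : ℕ) : ℝ)⁻¹) ^ (K - n) : ℝ) : ℂ) ^ 2 / 2) *
            ∑ p : Plaq (PV 2 ℓ m K hd3 hL) 0, Matrix.trace ((A' ⟨p.src, p.μ⟩ + A' ⟨p.src.shift p.μ, p.ν⟩ - A' ⟨p.src.shift p.ν, p.μ⟩ - A' ⟨p.src, p.ν⟩) *
              (((s ⟨p.src, p.μ⟩ : ℝ) : ℂ) • E + ((s ⟨p.src.shift p.μ, p.ν⟩ : ℝ) : ℂ) • E - ((s ⟨p.src.shift p.ν, p.μ⟩ : ℝ) : ℂ) • E -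
                ((s ⟨p.src, p.ν⟩ : ℝ) : ℂ) • E)) +
          (((((ℓ + 1 : ℕ) : ℝ)⁻¹) ^ (K - n) : ℝ) : ℂ) ^ 4 * ∑ b : PBond (PV 2 ℓ m K hd3 hL) 0, Matrix.trace (W₀ A' b * (((s b : ℝ) : ℂ) • E))).re = 0)
      (_ : ∀ φ : Matrix (Fin 2) (Fin 2) ℂ →ₗ[ℝ] ℝ,
        RE (cubeSeqMT3 (⟨ℓ + 1, hL, m, hm⟩ : T3Family) n K x₀ ρ S ((ℓ + 1) * Mh) hM1) ((((ℓ + 1 : ℕ) : ℝ)) ^ (K - n))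
          (dsE ((((ℓ + 1 : ℕ) : ℝ)) ^ (K - n)) (WithLp.toLp 2 (fun b => φ (A' b)))) = 0)
      (_ : r < a₃) (_ : ∀ b, w 1 b * ‖A' b‖ ≤ r)
      (_ : ∀ (b : PBond (PV 2 ℓ m K hd3 hL) 0) (ν : Fin 3), w 2 b * (((ℓ + 1 : ℕ) : ℝ)) ^ (K - n) * ‖A' ⟨b.src.shift ν, b.dir⟩ - A' b‖ ≤ r)
      (_ : B₀ * (2 * C₄ * r ^ 2) ≤ e) (_ : (1 + BM) * (2 * C₄ * r ^ 2) ≤ e),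
      (∀ (z : B7Prop1Explicit.Site (PV 2 ℓ m K hd3 hL).d) (τ : Fin (PV 2 ℓ m K hd3 hL).d),
        SideTouches (pullDom (fun j => if K - n ≤ j then ({x₀} : Set (Site (PV 2 ℓ m K hd3 hL) 0)) else (∅ : Set (Site (PV 2 ℓ m K hd3 hL) 0))) (K - n)) z τ →
        ‖(A' - fun b : PBond (PV 2 ℓ m K hd3 hL) 0 => ∑ c, flatH (⟨ℓ + 1, hL, m, hm⟩ : T3Family) n K (cubeSeqMT3 (⟨ℓ + 1, hL, m, hm⟩ : T3Family) n K x₀ ρ S ((ℓ + 1) * Mh) hM1) (Pi.single c 1) b •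
            bondAvgIter (c.1.1 : ℕ) A' c.1.2) ⟨transl 0 z, τ⟩‖ ≤ e) ∧
      (∀ (z : B7Prop1Explicit.Site (PV 2 ℓ m K hd3 hL).d) (κ τ : Fin (PV 2 ℓ m K hd3 hL).d),
        SideTouches (pullDom (fun j => if K - n ≤ j then ({x₀} : Set (Site (PV 2 ℓ m K hd3 hL) 0)) else (∅ : Set (Site (PV 2 ℓ m K hd3 hL) 0))) (K - n)) z τ →
        ‖(((((ℓ + 1 : ℕ) : ℝ))⁻¹) ^ (K - n))⁻¹ •
          ((A' - fun b : PBond (PV 2 ℓ m K hd3 hL) 0 => ∑ c, flatH (⟨ℓ + 1, hL, m, hm⟩ : T3Family) n K (cubeSeqMT3 (⟨ℓ + 1, hL, m, hm⟩ : T3Family) n K x₀ ρ S ((ℓ + 1) * Mh) hM1) (Pi.single c 1) b •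
              bondAvgIter (c.1.1 : ℕ) A' c.1.2) ⟨(transl 0 z).shift κ, τ⟩ -
            (A' - fun b : PBond (PV 2 ℓ m K hd3 hL) 0 => ∑ c, flatH (⟨ℓ + 1, hL, m, hm⟩ : T3Family) n K (cubeSeqMT3 (⟨ℓ + 1, hL, m, hm⟩ : T3Family) n K x₀ ρ S ((ℓ + 1) * Mh) hM1) (Pi.single c 1) b •
              bondAvgIter (c.1.1 : ℕ) A' c.1.2) ⟨transl 0 z, τ⟩)‖ ≤ e) ∧
      (∀ (z : B7Prop1Explicit.Site (PV 2 ℓ m K hd3 hL).d) (μ : Fin (PV 2 ℓ m K hd3 hL).d),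
        BondTouches (pullDom (fun j => if K - n ≤ j then ({x₀} : Set (Site (PV 2 ℓ m K hd3 hL) 0)) else (∅ : Set (Site (PV 2 ℓ m K hd3 hL) 0))) (K - n)) z μ →
        ‖pdiv (((((ℓ + 1 : ℕ) : ℝ))⁻¹) ^ (K - n)) (1 : B7Prop1Explicit.Site (PV 2 ℓ m K hd3 hL).d → Fin (PV 2 ℓ m K hd3 hL).d → (Matrix (Fin 2) (Fin 2) ℂ)ˣ)
            (plaqCovDeriv (((((ℓ + 1 : ℕ) : ℝ))⁻¹) ^ (K - n))
              (1 : B7Prop1Explicit.Site (PV 2 ℓ m K hd3 hL).d → Fin (PV 2 ℓ m K hd3 hL).d → (Matrix (Fin 2) (Fin 2) ℂ)ˣ)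
              (pull (A' - fun b : PBond (PV 2 ℓ m K hd3 hL) 0 => ∑ c, flatH (⟨ℓ + 1, hL, m, hm⟩ : T3Family) n K (cubeSeqMT3 (⟨ℓ + 1, hL, m, hm⟩ : T3Family) n K x₀ ρ S ((ℓ + 1) * Mh) hM1)
                (Pi.single c 1) b • bondAvgIter (c.1.1 : ℕ) A' c.1.2) 0)) μ z‖ ≤ e) := by
  obtain ⟨Mh₀, R₀, B₀, BM, hB₀, hBM, hmain⟩ := row165_of_tracePairing_L5 ℓ hL hℓ
  refine ⟨Mh₀, R₀, B₀, BM, hB₀, hBM, ?_⟩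
  intro m hm n K hk1 hk' Mh R a' hMha hMh hR hsize hM1 x₀ ρ S hRS hρ1 w hw A' hA' W₀ C₄ a₃ r e hWq hpair hslice hr h1 h2 he₁ he₂
  -- the self-adjoint part of the current
  refine hmain m hm n K hk1 hk' hMha hMh hR hsize hM1 x₀ ρ S hRS hρ1 w hw A' hA' (fun Y b => (1 / 2 : ℝ) • (W₀ Y b + (W₀ Y b)ᴴ))
    (fun b => isSelfAdjoint_hermPart (W₀ A' b)) (fun Y r' hr' hY1 hY2 b => ?_) (fun s hs E hE => ?_) hslice hr h1 h2 he₁ he₂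
  · -- (98) for the self-adjoint part
    have h := hWq Y r' hr' hY1 hY2 b
    have hw3 : 0 ≤ w 3 b := by rw [hw 3 b]; positivity
    exact (mul_le_mul_of_nonneg_left (norm_hermPart_le (W₀ Y b)) hw3).trans h
  · -- the pairing does not see the anti-self-adjoint part
    have h := hpair s hs E hE
    have key : ∀ X : PBond (PV 2 ℓ m K hd3 hL) 0 → Matrix (Fin 2) (Fin 2) ℂ,
        (((((((ℓ + 1 : ℕ) : ℝ)⁻¹) ^ (K - n) : ℝ) : ℂ) ^ 2 / 2) *
            ∑ p : Plaq (PV 2 ℓ m K hd3 hL) 0, Matrix.trace ((A' ⟨p.src, p.μ⟩ + A' ⟨p.src.shift p.μ, p.ν⟩ - A' ⟨p.src.shift p.ν, p.μ⟩ - A' ⟨p.src, p.ν⟩) *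
              (((s ⟨p.src, p.μ⟩ : ℝ) : ℂ) • E + ((s ⟨p.src.shift p.μ, p.ν⟩ : ℝ) : ℂ) • E - ((s ⟨p.src.shift p.ν, p.μ⟩ : ℝ) : ℂ) • E -
                ((s ⟨p.src, p.ν⟩ : ℝ) : ℂ) • E)) +
          (((((ℓ + 1 : ℕ) : ℝ)⁻¹) ^ (K - n) : ℝ) : ℂ) ^ 4 * ∑ b : PBond (PV 2 ℓ m K hd3 hL) 0, Matrix.trace (X b * (((s b : ℝ) : ℂ) • E))).re =
        (((((((ℓ + 1 : ℕ) : ℝ)⁻¹) ^ (K - n) : ℝ) : ℂ) ^ 2 / 2) *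
            ∑ p : Plaq (PV 2 ℓ m K hd3 hL) 0, Matrix.trace ((A' ⟨p.src, p.μ⟩ + A' ⟨p.src.shift p.μ, p.ν⟩ - A' ⟨p.src.shift p.ν, p.μ⟩ - A' ⟨p.src, p.ν⟩) *
              (((s ⟨p.src, p.μ⟩ : ℝ) : ℂ) • E + ((s ⟨p.src.shift p.μ, p.ν⟩ : ℝ) : ℂ) • E - ((s ⟨p.src.shift p.ν, p.μ⟩ : ℝ) : ℂ) • E -
                ((s ⟨p.src, p.ν⟩ : ℝ) : ℂ) • E))).re +
          ((((ℓ + 1 : ℕ) : ℝ)⁻¹) ^ (K - n)) ^ 4 * ∑ b : PBond (PV 2 ℓ m K hd3 hL) 0, (Matrix.trace (X b * (((s b : ℝ) : ℂ) • E))).re := by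
      intro X
      rw [Complex.add_re]
      congr 1
      rw [Complex.mul_re, ← Complex.ofReal_pow, Complex.ofReal_re, Complex.ofReal_im, zero_mul, sub_zero, Complex.re_sum]
    rw [key] at h ⊢
    have hre : ∀ b : PBond (PV 2 ℓ m K hd3 hL) 0, (Matrix.trace (((1 / 2 : ℝ) • (W₀ A' b + (W₀ A' b)ᴴ)) * (((s b : ℝ) : ℂ) • E))).re =
        (Matrix.trace (W₀ A' b * (((s b : ℝ) : ℂ) • E))).re := fun b => (re_trace_mul_eq_hermPart (W₀ A' b) E hE (s b)).symm
    simp only [hre]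
    exact h

end Carrier

end Summit.QuantumFields.YangMills.Theorems.HalvingA1Row165TraceAnyW

end
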